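import Summits.BirchSwinnertonDyer.BirchSwinnertonDyer.Theses.CycTangentCM
import Literature.NumberTheory.EllipticCurves.DeShalit1987.SplitPrimeMuVanishing
import HarnessLib

/-!
# `TwoVarUnitContent` (route `CycTangentCM`, item stmt-BirchSwinnertonDyer-22632) GRANTED Gillard's
# theorem in its two-variable form — the conditional closer

Seat `prover-bsd-line-ctcm-p3` (D-0145 line `route-BirchSwinnertonDyer-CycTangentCM`, prover 3/3).

HONEST FRAMING. The support item `TwoVarUnitContent` ("two-variable unit content (`μ = 0` of the
`ψ⁻¹`-twisted two-variable Katz–de Shalit measure) … Published: Gillard 1985 … Schneps 1987; de Shalit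
1987 III") is a PUBLISHED theorem read on the cell's frame `IsKatzMeasure₂`; the tree holds no proof of
Gillard's theorem (Coleman series of elliptic units + Sinnott's algebraic independence), so the item
is closed here MODULO the named fact
`Literature.NumberTheory.EllipticCurves.DeShalit1987.thmIII212_exists_isUnit_coeff_katzMeasure₂`
(de Shalit 1987 III.2.12 = Gillard 1985 Thm. 2.9 / Schneps 1987 Thm. IV, two-variable transcription on
`IsKatzMeasure₂`; file `Literature/NumberTheory/EllipticCurves/DeShalit1987/SplitPrimeMuVanishing.lean`,
which also carries the one-variable VERBATIM form `thmIII212_hasUnitContent_katzBranch` on the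
split-prime line): `twoVarUnitContent_of_thmIII212 (h) : TwoVarUnitContent` is CONDITIONAL on exactly
that fact and on nothing else. The frame check asked for by the route critic (price (4): "the grounder
should check the frame's generality matches Gillard's hypotheses") is the body of the proof: the item's
binders give `p ≥ 5` (Gillard: `p ≠ 2, 3`), `p = v v̄` SPLIT in the CM field `K` (imaginary quadratic:
`IsCMFieldOfJ` + `IsCMFieldOfJ.isTotallyComplex`), the twist `λ = ψ_A⁻¹` ALGEBRAIC of type `(−1, 0)`
(`HasInfinityType.inv`) and UNRAMIFIED OFF the exact modulus `S` (`IsUnramifiedAt.inv'`; `v, v̄ ∉ S`),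
admissible periods `Ω ≠ 0`, `Ω_p ≠ 0`, `δ² = ±d_K`, and a generator pair of the `ℤ_p²`-extension
(`IsTopGeneratorPair`; that `κ₂` is cyclotomic and `γ₂` normalised is not needed) — every hypothesis of
the fact is among the item's binders, and the two hypotheses `A.HasIrreducibleModPGaloisRep p`,
`¬ p ∣ a_p(A)` beyond "`p` splits" are carried unused (as the refuter's mutation note predicted).
Nothing here touches the cyclotomic (inner) line `PowerSeries.constantCoeff G`, i.e. the cruxes
`CycTangentBound` (22628) / `MuZeroCMCurves` (19234): two-variable unit content does not descend to a
line (`Theorems/MuZeroCMCurves/Negative/NoAxisTransport.lean`). BSD is not proved by any of this.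

## Contents (proved; no `def`, no `sorry`)

* `twoVarUnitContent_of_thmIII212` — the conditional closer (instantiate the fact at `λ = ψ⁻¹`, type
  `(−1, 0)` by `HasInfinityType.inv`, unramified off `S` by `IsUnramifiedAt.inv'`).

References: R. Gillard, J. reine angew. Math. 358 (1985), Thm. 2.9 [Gillard1985]; E. de Shalit,
*Iwasawa theory of elliptic curves with complex multiplication* (1987), III.1.11, III.2.12, II.4.17 (54)
[deShalit1987]; L. Schneps, J. Number Theory 25 (1987), Thm. IV [Schneps1987]; Coates–Fukaya–Kato–
Sujatha–Venjakob, Publ. IHÉS 101 (2005), proof of Cor. 5.5.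
-/

-- the summit namespace `Summit.BirchSwinnertonDyer.BirchSwinnertonDyer` repeats the problem name by design (D-0017)
set_option linter.dupNamespace false
set_option autoImplicit false

noncomputable section

open Literature.NumberTheory.GaloisRepresentations
open Literature.NumberTheory.EllipticCurves
open Literature.NumberTheory.EllipticCurves.GreenbergVatsal2000

namespace Summit.BirchSwinnertonDyer.BirchSwinnertonDyer.Theorems

/-! ### The conditional closer -/

/-- **`TwoVarUnitContent` granted Gillard's theorem (two-variable form).** For every CM anchor curve
`A/ℚ`, good ordinary `p ≥ 5` with `A[p]` irreducible, and every frame package `(K, ψ, ι, v, v̄, S, κ₁,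
κ₂; γ₁, γ₂, Ω, δ, Ω_p, G)` of the katz-cyc-axis line, some coefficient `[T₁^i T₂^j]G` of the
`ψ⁻¹`-twisted two-variable Katz–de Shalit germ is a unit — obtained by instantiating the named fact
`DeShalit1987.thmIII212_exists_isUnit_coeff_katzMeasure₂` (de Shalit III.2.12 = Gillard 1985 Thm. 2.9,
two-variable transcription) at the twist `λ = ψ⁻¹` of type `(−1, 0)`, unramified off `S`.
CONDITIONAL on that fact (hypothesis `h`); unconditional in everything else. -/
theorem twoVarUnitContent_of_thmIII212
    (h : DeShalit1987.thmIII212_exists_isUnit_coeff_katzMeasure₂) :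
    Summit.BirchSwinnertonDyer.BirchSwinnertonDyer.Theses.CycTangentCM.TwoVarUnitContent := by
  intro A _ _ p _ hp hj _hgood _hord _hirr K _ _ hK ψ hψ _hL ι v vbar hv hvbar hne hι S hvS hvbarS
    _hSram hSunr κ₁ κ₂ γ₁ γ₂ hpair _hcyc _hγ₂ Ω δ Ωp hΩ hΩp hδ G hG
  have hK' : IsImaginaryQuadratic K := ⟨hK.1, IsCMFieldOfJ.isTotallyComplex hj hK⟩
  have hψ' : ψ⁻¹.HasInfinityType (fun _ ↦ (-1 : ℤ)) (fun _ ↦ (0 : ℤ)) := by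
    simpa [Pi.neg_def] using hψ.inv
  have hunr : ∀ w : IsDedekindDomain.HeightOneSpectrum (NumberField.RingOfIntegers K), w ∉ S →
      ψ⁻¹.IsUnramifiedAt w :=
    fun w hw ↦ (hSunr w hw).inv'
  exact h p K hp hK' ι v vbar hv hvbar hne hι S hvS hvbarS κ₁ κ₂ γ₁ γ₂ hpair ψ⁻¹ (-1) 0 hψ' hunr
    Ω δ Ωp hΩ hΩp hδ G hG

end Summit.BirchSwinnertonDyer.BirchSwinnertonDyer.Theorems
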